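import Literature.MathematicalPhysics.QuantumFieldTheory.Balaban1983to89.B7Eq31BCH
import Literature.Analysis.Complex.RungeUnits
import Summits.QuantumFields.YangMills.Theorems.EquipartitionCriticalityFreeEnergyLogCoefficientExpLipschitz
import HarnessLib

/-!
# Route `UnitScaleTilt`, crux K1 «MinimiserStabilityRegPr» (stmt-QuantumFields-19200), route-R E′ path (α′), row (P-bch-div) — the missing letter (C¹-BCH):
# THE BCH REMAINDER `r(X,Y) = log(eˣe^Y) − X − Y` IS BILINEARLY LIPSCHITZ —
# `‖r(X,Y) − r(X′,Y′)‖ ≤ (2Q∕((1−S)(1−P)))·‖eˣ − e^{X′}‖ + (2P∕((1−S)(1−Q)))·‖e^Y − e^{Y′}‖`, `P ≥ ‖e^{X⁽′⁾} − 1‖`, `Q ≥ ‖e^{Y⁽′⁾} − 1‖`, `S = P + Q + PQ < 1`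

Cell `ym3-torus`, width seat `ym3-torus-px15` (gen 0); pen (P-bch-div) named by ★p1 g14 (2026-08-28 17:39Z).  THEOREMS ONLY (0 `def`, 0 `sorry`); `--supports stmt-QuantumFields-19200`,
count-neutral.  YM₃ on T³ is a ladder rung (R3), not the Clay problem; nothing here claims a stub, the crux, d = 4 or the mass gap.

WHY.  The divergence row of (P-bch) (`Σ_x‖D*_W R₂‖² ≤ C′s_Q²(K + (C_blk+1)ℓ⁻²M)`, ★p1 g14) needs bondwise DIFFERENCES of the chart remainder `R₂` of ✓ `Prop7PinnedRegaugeChartBCH`, with a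
SMALL prefactor (memo `LOCATE-PBCH-DIV-px15.md`: the crude Lipschitz route loses `ℓ²`).  `R₂` is a sum of an explicitly bilinear term and two BCH remainders `r(·,·)`; the tree has the
SIZE of `r` ([Balaban1985Averaging] (31), ✓ `B7Eq31BCH.eq31_of_sum_le`) but not its Lipschitz behaviour.  THIS FILE: `r` is Lipschitz in `(eˣ, e^Y)` with constants proportional to
the OTHER variable — the derivative of (31)'s own majorant.  With `p = eˣ − 1`, `q = e^Y − 1`, ✓ `B7Eq31BCH.hasSum_bch_sub` writes `r = Σ_n c_n·T_n(p,q)`, `T_n = (p+q+pq)ⁿ − pⁿ − qⁿ`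
(every word contains both letters); the recursion ✓ `B7Eq31BCH.mixedPow_succ` differentiates into a recursion for `T_n(p,q) − T_n(p′,q′)` whose majorant is EXACTLY the formal
derivative of the word majorant `M_n(P,Q) = (P+Q+PQ)ⁿ − Pⁿ − Qⁿ` of ✓ `norm_mixedPow_le`: `‖T_n − T_n′‖ ≤ ∂_P M_n·‖p − p′‖ + ∂_Q M_n·‖q − q′‖`; summing `Σ_n ∂_P M_n∕n = (1+Q)∕(1−S) −
1∕(1−P) = 2Q∕((1−S)(1−P))` (geometric series) gives the title bound — bilinear: the `‖p − p′‖`-coefficient is `O(Q)`, the `‖q − q′‖`-coefficient `O(P)`.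

WHAT IS PROVED (ns `…Theorems.Prop7BCHRemainderLipschitz`; any complete normed ℂ-algebra).
* §1 words (any normed ring; `‖x^{n+1} − y^{n+1}‖ ≤ (n+1)rⁿ‖x − y‖` is ✓ `FreeEnergyLogCoefficient.norm_pow_succ_sub_pow_succ_le`, reused): `mixedPow_succ_sub` (the difference recursion), ★★ `norm_mixedPow_sub_le`
  (`‖T_{n+1}(p,q) − T_{n+1}(p′,q′)‖ ≤ (n+1)((P+Q+PQ)ⁿ(1+Q) − Pⁿ)·‖p − p′‖ + (n+1)((P+Q+PQ)ⁿ(1+P) − Qⁿ)·‖q − q′‖`).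
* §2 series: `hasSum_derivMajorant` (the real majorant sums to `((1+Q)∕(1−S) − 1∕(1−P))·a + ((1+P)∕(1−S) − 1∕(1−Q))·b`), ★★★ `norm_bch_sub_bch_le` (the title bound, hypotheses
  `‖X‖, ‖X′‖, ‖Y‖, ‖Y′‖ < ln 2`, `‖e^{X⁽′⁾} − 1‖ ≤ P`, `‖e^{Y⁽′⁾} − 1‖ ≤ Q`, `P + Q + PQ < 1`), `coeff_le`, and the letter forms ★★ `norm_bch_sub_bch_le_of_norm_le` (`‖X⁽′⁾‖ ≤ m_X ≤ 1∕40`, `‖Y⁽′⁾‖ ≤ m_Y ≤ 1∕40` ⇒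
  `‖r(X,Y) − r(X′,Y′)‖ ≤ 4·m_Y·‖X − X′‖ + 4·m_X·‖Y − Y′‖`) and `norm_bch_sub_bch_le_max` (`m = max`).
HONEST SCOPE.  Pure normed-algebra analysis ([folklore] estimates over the tree's (21)∕(31) machinery); the assembly of the (P-bch-div) row (covariant differences in the door's
`divB (torusT …)` letters, Weitzenböck ✓ `Prop7CovariantCoercivity.sum_covD_sq_le_curl_sq_add_divB_sq`, ✓p648418) is NOT here.  Constants ours.

References: T. Bałaban, CMP 98 (1985) 17–51 [Balaban1985Averaging] ((21) p.21, (28)–(31) p.22).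
-/

set_option autoImplicit false

noncomputable section

open NormedSpace

namespace Summit.QuantumFields.YangMills.Theorems.Prop7BCHRemainderLipschitz

open Literature.MathematicalPhysics.QuantumFieldTheory.Balaban1983to89
open B7Eq31BCH (mixedPow_succ norm_mixedPow_le hasSum_bch_sub exp_mul_exp_sub_one)
open MatrixLog (mlog norm_logSeriesCoeff_succ)
open Literature.Analysis.Complex (logSeriesCoeff logSeriesCoeff_zero)
open Summit.QuantumFields.YangMills.Theorems.FreeEnergyLogCoefficient (norm_pow_succ_sub_pow_succ_le)

/-! ## §1 Words: the difference recursion and its majorant (the formal derivative of `(P+Q+PQ)ⁿ − Pⁿ − Qⁿ`) -/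

section Words

variable {𝔸 : Type*} [NormedRing 𝔸]

/-- **The difference recursion.**  With `s = p + q + pq`, `T_n(p,q) = sⁿ − pⁿ − qⁿ` and primed letters for `(p′,q′)`:
`T_{n+2} − T′_{n+2} = s(T_{n+1} − T′_{n+1}) + (s − s′)T′_{n+1} + (q + pq)(p^{n+1} − p′^{n+1}) + ((q + pq) − (q′ + p′q′))p′^{n+1} + (p + pq)(q^{n+1} − q′^{n+1}) +
((p + pq) − (p′ + p′q′))q′^{n+1}` (✓ `B7Eq31BCH.mixedPow_succ` twice). [folklore] [cite: Balaban1985Averaging, (28) p.22] -/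
theorem mixedPow_succ_sub (p q p' q' : 𝔸) (n : ℕ) :
    ((p + q + p * q) ^ (n + 2) - p ^ (n + 2) - q ^ (n + 2)) - ((p' + q' + p' * q') ^ (n + 2) - p' ^ (n + 2) - q' ^ (n + 2))
      = (p + q + p * q) * (((p + q + p * q) ^ (n + 1) - p ^ (n + 1) - q ^ (n + 1)) - ((p' + q' + p' * q') ^ (n + 1) - p' ^ (n + 1) - q' ^ (n + 1)))
        + ((p + q + p * q) - (p' + q' + p' * q')) * ((p' + q' + p' * q') ^ (n + 1) - p' ^ (n + 1) - q' ^ (n + 1))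
        + (q + p * q) * (p ^ (n + 1) - p' ^ (n + 1)) + ((q + p * q) - (q' + p' * q')) * p' ^ (n + 1)
        + (p + p * q) * (q ^ (n + 1) - q' ^ (n + 1)) + ((p + p * q) - (p' + p' * q')) * q' ^ (n + 1) := by
  rw [mixedPow_succ, mixedPow_succ]
  noncomm_ring

/-- ★★ **THE DIFFERENCE MAJORANT = the formal derivative of the word majorant.**  If `‖p‖, ‖p′‖ ≤ P` and `‖q‖, ‖q′‖ ≤ Q` then for every `n`,
`‖T_{n+1}(p,q) − T_{n+1}(p′,q′)‖ ≤ (n+1)·((P+Q+PQ)ⁿ(1+Q) − Pⁿ)·‖p − p′‖ + (n+1)·((P+Q+PQ)ⁿ(1+P) − Qⁿ)·‖q − q′‖` — i.e. `≤ ∂_P M_{n+1}·‖p−p′‖ + ∂_Q M_{n+1}·‖q−q′‖` with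
`M_n = (P+Q+PQ)ⁿ − Pⁿ − Qⁿ` the majorant of ✓ `norm_mixedPow_le`; the coefficients vanish to the right order (`n = 0`: `Q‖p−p′‖ + P‖q−q′‖`). [folklore] [cite: Balaban1985Averaging, (28)-(31) p.22] -/
theorem norm_mixedPow_sub_le {p q p' q' : 𝔸} {P Q : ℝ} (hp : ‖p‖ ≤ P) (hp' : ‖p'‖ ≤ P) (hq : ‖q‖ ≤ Q) (hq' : ‖q'‖ ≤ Q) :
    ∀ n : ℕ, ‖((p + q + p * q) ^ (n + 1) - p ^ (n + 1) - q ^ (n + 1)) - ((p' + q' + p' * q') ^ (n + 1) - p' ^ (n + 1) - q' ^ (n + 1))‖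
      ≤ (n + 1) * ((P + Q + P * Q) ^ n * (1 + Q) - P ^ n) * ‖p - p'‖ + (n + 1) * ((P + Q + P * Q) ^ n * (1 + P) - Q ^ n) * ‖q - q'‖
  | 0 => by
    have hP : 0 ≤ P := (norm_nonneg p).trans hp
    have e : ((p + q + p * q) ^ (0 + 1) - p ^ (0 + 1) - q ^ (0 + 1)) - ((p' + q' + p' * q') ^ (0 + 1) - p' ^ (0 + 1) - q' ^ (0 + 1))
        = (p - p') * q + p' * (q - q') := by
      simp only [zero_add, pow_one]; noncomm_ring
    rw [e]
    calc ‖(p - p') * q + p' * (q - q')‖ ≤ ‖p - p'‖ * ‖q‖ + ‖p'‖ * ‖q - q'‖ := (norm_add_le _ _).trans (add_le_add (norm_mul_le _ _) (norm_mul_le _ _))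
      _ ≤ ‖p - p'‖ * Q + P * ‖q - q'‖ := by gcongr
      _ = _ := by ring
  | n + 1 => by
    have ih := norm_mixedPow_sub_le hp hp' hq hq' n
    have hP : 0 ≤ P := (norm_nonneg p).trans hp
    have hQ : 0 ≤ Q := (norm_nonneg q).trans hq
    have hdp : 0 ≤ ‖p - p'‖ := norm_nonneg _
    have hdq : 0 ≤ ‖q - q'‖ := norm_nonneg _
    set S : ℝ := P + Q + P * Q with hS
    have hSP : P ≤ S := by rw [hS]; nlinarith
    have hSQ : Q ≤ S := by rw [hS]; nlinarith
    have hS0 : 0 ≤ S := hP.trans hSP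
    -- norms of the letters
    have hs : ‖p + q + p * q‖ ≤ S := norm_add₃_le.trans (by rw [hS]; exact add_le_add (add_le_add hp hq) (norm_mul_le_of_le hp hq))
    have hs' : ‖(p + q + p * q) - (p' + q' + p' * q')‖ ≤ (1 + Q) * ‖p - p'‖ + (1 + P) * ‖q - q'‖ := by
      have e : (p + q + p * q) - (p' + q' + p' * q') = (p - p') + (q - q') + ((p - p') * q + p' * (q - q')) := by noncomm_ring
      rw [e]
      calc _ ≤ ‖p - p'‖ + ‖q - q'‖ + ‖(p - p') * q + p' * (q - q')‖ := norm_add₃_le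
        _ ≤ ‖p - p'‖ + ‖q - q'‖ + (‖p - p'‖ * ‖q‖ + ‖p'‖ * ‖q - q'‖) := by
            gcongr; exact (norm_add_le _ _).trans (add_le_add (norm_mul_le _ _) (norm_mul_le _ _))
        _ ≤ ‖p - p'‖ + ‖q - q'‖ + (‖p - p'‖ * Q + P * ‖q - q'‖) := by gcongr
        _ = _ := by ring
    have hM : ‖(p' + q' + p' * q') ^ (n + 1) - p' ^ (n + 1) - q' ^ (n + 1)‖ ≤ S ^ (n + 1) - P ^ (n + 1) - Q ^ (n + 1) := by
      rw [hS]; exact norm_mixedPow_le hp' hq' n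
    have hqpq : ‖q + p * q‖ ≤ Q + P * Q := norm_add_le_of_le hq (norm_mul_le_of_le hp hq)
    have hppq : ‖p + p * q‖ ≤ P + P * Q := norm_add_le_of_le hp (norm_mul_le_of_le hp hq)
    have hdqpq : ‖(q + p * q) - (q' + p' * q')‖ ≤ Q * ‖p - p'‖ + (1 + P) * ‖q - q'‖ := by
      have e : (q + p * q) - (q' + p' * q') = (q - q') + ((p - p') * q + p' * (q - q')) := by noncomm_ring
      rw [e]
      calc _ ≤ ‖q - q'‖ + ‖(p - p') * q + p' * (q - q')‖ := norm_add_le _ _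
        _ ≤ ‖q - q'‖ + (‖p - p'‖ * ‖q‖ + ‖p'‖ * ‖q - q'‖) := by
            gcongr; exact (norm_add_le _ _).trans (add_le_add (norm_mul_le _ _) (norm_mul_le _ _))
        _ ≤ ‖q - q'‖ + (‖p - p'‖ * Q + P * ‖q - q'‖) := by gcongr
        _ = _ := by ring
    have hdppq : ‖(p + p * q) - (p' + p' * q')‖ ≤ (1 + Q) * ‖p - p'‖ + P * ‖q - q'‖ := by
      have e : (p + p * q) - (p' + p' * q') = (p - p') + ((p - p') * q + p' * (q - q')) := by noncomm_ring
      rw [e]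
      calc _ ≤ ‖p - p'‖ + ‖(p - p') * q + p' * (q - q')‖ := norm_add_le _ _
        _ ≤ ‖p - p'‖ + (‖p - p'‖ * ‖q‖ + ‖p'‖ * ‖q - q'‖) := by
            gcongr; exact (norm_add_le _ _).trans (add_le_add (norm_mul_le _ _) (norm_mul_le _ _))
        _ ≤ ‖p - p'‖ + (‖p - p'‖ * Q + P * ‖q - q'‖) := by gcongr
        _ = _ := by ring
    have hpn : ‖p ^ (n + 1) - p' ^ (n + 1)‖ ≤ (n + 1) * P ^ n * ‖p - p'‖ := norm_pow_succ_sub_pow_succ_le hp hp' n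
    have hqn : ‖q ^ (n + 1) - q' ^ (n + 1)‖ ≤ (n + 1) * Q ^ n * ‖q - q'‖ := norm_pow_succ_sub_pow_succ_le hq hq' n
    have hp'n : ‖p' ^ (n + 1)‖ ≤ P ^ (n + 1) := (norm_pow_le' p' n.succ_pos).trans (pow_le_pow_left₀ (norm_nonneg _) hp' _)
    have hq'n : ‖q' ^ (n + 1)‖ ≤ Q ^ (n + 1) := (norm_pow_le' q' n.succ_pos).trans (pow_le_pow_left₀ (norm_nonneg _) hq' _)
    -- nonnegativity of the majorants
    have hSn : P ^ n ≤ S ^ n := pow_le_pow_left₀ hP hSP n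
    have hSn' : Q ^ n ≤ S ^ n := pow_le_pow_left₀ hQ hSQ n
    have hA : 0 ≤ (n + 1) * (S ^ n * (1 + Q) - P ^ n) := by
      have : P ^ n ≤ S ^ n * (1 + Q) := hSn.trans (le_mul_of_one_le_right (pow_nonneg hS0 n) (by linarith))
      have hn : (0 : ℝ) ≤ n + 1 := by positivity
      exact mul_nonneg hn (by linarith)
    have hB : 0 ≤ (n + 1) * (S ^ n * (1 + P) - Q ^ n) := by
      have : Q ^ n ≤ S ^ n * (1 + P) := hSn'.trans (le_mul_of_one_le_right (pow_nonneg hS0 n) (by linarith))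
      have hn : (0 : ℝ) ≤ n + 1 := by positivity
      exact mul_nonneg hn (by linarith)
    have hMnn : 0 ≤ S ^ (n + 1) - P ^ (n + 1) - Q ^ (n + 1) := (norm_nonneg _).trans hM
    have ht0 : 0 ≤ ‖((p + q + p * q) ^ (n + 1) - p ^ (n + 1) - q ^ (n + 1)) - ((p' + q' + p' * q') ^ (n + 1) - p' ^ (n + 1) - q' ^ (n + 1))‖ := norm_nonneg _
    rw [show n + 1 + 1 = n + 2 by ring, mixedPow_succ_sub]
    calc _ ≤ ‖(p + q + p * q) * (((p + q + p * q) ^ (n + 1) - p ^ (n + 1) - q ^ (n + 1)) - ((p' + q' + p' * q') ^ (n + 1) - p' ^ (n + 1) - q' ^ (n + 1)))‖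
            + ‖((p + q + p * q) - (p' + q' + p' * q')) * ((p' + q' + p' * q') ^ (n + 1) - p' ^ (n + 1) - q' ^ (n + 1))‖
            + ‖(q + p * q) * (p ^ (n + 1) - p' ^ (n + 1))‖ + ‖((q + p * q) - (q' + p' * q')) * p' ^ (n + 1)‖
            + ‖(p + p * q) * (q ^ (n + 1) - q' ^ (n + 1))‖ + ‖((p + p * q) - (p' + p' * q')) * q' ^ (n + 1)‖ := by
          refine (norm_add_le _ _).trans (add_le_add ((norm_add_le _ _).trans (add_le_add ((norm_add_le _ _).trans (add_le_add
            ((norm_add_le _ _).trans (add_le_add ((norm_add_le _ _).trans (add_le_add le_rfl le_rfl)) le_rfl)) le_rfl)) le_rfl)) le_rfl)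
      _ ≤ S * ((n + 1) * (S ^ n * (1 + Q) - P ^ n) * ‖p - p'‖ + (n + 1) * (S ^ n * (1 + P) - Q ^ n) * ‖q - q'‖)
            + ((1 + Q) * ‖p - p'‖ + (1 + P) * ‖q - q'‖) * (S ^ (n + 1) - P ^ (n + 1) - Q ^ (n + 1))
            + (Q + P * Q) * ((n + 1) * P ^ n * ‖p - p'‖) + (Q * ‖p - p'‖ + (1 + P) * ‖q - q'‖) * P ^ (n + 1)
            + (P + P * Q) * ((n + 1) * Q ^ n * ‖q - q'‖) + ((1 + Q) * ‖p - p'‖ + P * ‖q - q'‖) * Q ^ (n + 1) := by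
          have ihS : ‖((p + q + p * q) ^ (n + 1) - p ^ (n + 1) - q ^ (n + 1)) - ((p' + q' + p' * q') ^ (n + 1) - p' ^ (n + 1) - q' ^ (n + 1))‖
              ≤ (n + 1) * (S ^ n * (1 + Q) - P ^ n) * ‖p - p'‖ + (n + 1) * (S ^ n * (1 + P) - Q ^ n) * ‖q - q'‖ := by
            simpa only [hS] using ih
          gcongr ?_ + ?_ + ?_ + ?_ + ?_ + ?_
          · exact norm_mul_le_of_le hs ihS
          · exact norm_mul_le_of_le hs' hM
          · exact norm_mul_le_of_le hqpq hpn
          · exact norm_mul_le_of_le hdqpq hp'n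
          · exact norm_mul_le_of_le hppq hqn
          · exact norm_mul_le_of_le hdppq hq'n
      _ = ((n + 1 : ℕ) + 1) * (S ^ (n + 1) * (1 + Q) - P ^ (n + 1)) * ‖p - p'‖
            + ((n + 1 : ℕ) + 1) * (S ^ (n + 1) * (1 + P) - Q ^ (n + 1)) * ‖q - q'‖ := by
          rw [hS]; push_cast; ring

end Words

/-! ## §2 The series: `r(X,Y) − r(X′,Y′)` and its bilinear majorant -/

section Series

variable {𝔸 : Type*} [NormedRing 𝔸] [NormedAlgebra ℂ 𝔸] [CompleteSpace 𝔸]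

omit [NormedAlgebra ℂ 𝔸] [CompleteSpace 𝔸] in
/-- The real majorant series: `Σ_{n≥0} ((S ⁿ(1+Q) − Pⁿ)·a + (Sⁿ(1+P) − Qⁿ)·b) = ((1+Q)∕(1−S) − 1∕(1−P))·a + ((1+P)∕(1−S) − 1∕(1−Q))·b` for `0 ≤ P, Q`, `S = P+Q+PQ < 1`
(three geometric series). [folklore] -/
theorem hasSum_derivMajorant {P Q : ℝ} (hP : 0 ≤ P) (hQ : 0 ≤ Q) (hS : P + Q + P * Q < 1) (a b : ℝ) :
    HasSum (fun n : ℕ => ((P + Q + P * Q) ^ n * (1 + Q) - P ^ n) * a + ((P + Q + P * Q) ^ n * (1 + P) - Q ^ n) * b)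
      ( ((1 + Q) / (1 - (P + Q + P * Q)) - 1 / (1 - P)) * a + ((1 + P) / (1 - (P + Q + P * Q)) - 1 / (1 - Q)) * b ) := by
  have hS0 : 0 ≤ P + Q + P * Q := by nlinarith
  have hP1 : P < 1 := by nlinarith
  have hQ1 : Q < 1 := by nlinarith
  have gS := hasSum_geometric_of_lt_one hS0 hS
  have gP := hasSum_geometric_of_lt_one hP hP1
  have gQ := hasSum_geometric_of_lt_one hQ hQ1
  have h1 : HasSum (fun n : ℕ => ((P + Q + P * Q) ^ n * (1 + Q) - P ^ n) * a) ((((1 - (P + Q + P * Q))⁻¹ * (1 + Q)) - (1 - P)⁻¹) * a) :=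
    ((gS.mul_right (1 + Q)).sub gP).mul_right a
  have h2 : HasSum (fun n : ℕ => ((P + Q + P * Q) ^ n * (1 + P) - Q ^ n) * b) ((((1 - (P + Q + P * Q))⁻¹ * (1 + P)) - (1 - Q)⁻¹) * b) :=
    ((gS.mul_right (1 + P)).sub gQ).mul_right b
  convert h1.add h2 using 1
  simp only [div_eq_mul_inv, one_mul]
  ring

/-- ★★★ **THE BCH REMAINDER IS BILINEARLY LIPSCHITZ.**  For `‖X‖, ‖X′‖, ‖Y‖, ‖Y′‖ < ln 2` with `‖eˣ − 1‖, ‖e^{X′} − 1‖ ≤ P`, `‖e^Y − 1‖, ‖e^{Y′} − 1‖ ≤ Q`, `S := P + Q + PQ < 1`: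
`‖(log(eˣe^Y) − X − Y) − (log(e^{X′}e^{Y′}) − X′ − Y′)‖ ≤ ((1+Q)∕(1−S) − 1∕(1−P))·‖eˣ − e^{X′}‖ + ((1+P)∕(1−S) − 1∕(1−Q))·‖e^Y − e^{Y′}‖`
(`(1+Q)∕(1−S) − 1∕(1−P) = 2Q∕((1−S)(1−P))`: the `‖eˣ − e^{X′}‖`-coefficient is `O(Q)`, the `‖e^Y − e^{Y′}‖`-coefficient `O(P)`).  Proof: ✓ `hasSum_bch_sub` for both pairs, `norm_mixedPow_sub_le`
termwise with `‖c_{n+1}‖ = 1∕(n+1)`, `hasSum_derivMajorant`. [cite: Balaban1985Averaging, (21) p.21, (28)-(31) p.22] -/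
theorem norm_bch_sub_bch_le {X Y X' Y' : 𝔸} {P Q : ℝ}
    (hX : ‖X‖ < Real.log 2) (hY : ‖Y‖ < Real.log 2) (hX' : ‖X'‖ < Real.log 2) (hY' : ‖Y'‖ < Real.log 2)
    (hpX : ‖exp X - 1‖ ≤ P) (hpX' : ‖exp X' - 1‖ ≤ P) (hqY : ‖exp Y - 1‖ ≤ Q) (hqY' : ‖exp Y' - 1‖ ≤ Q) (hS : P + Q + P * Q < 1) :
    ‖(mlog (exp X * exp Y) - X - Y) - (mlog (exp X' * exp Y') - X' - Y')‖
      ≤ ((1 + Q) / (1 - (P + Q + P * Q)) - 1 / (1 - P)) * ‖exp X - exp X'‖ + ((1 + P) / (1 - (P + Q + P * Q)) - 1 / (1 - Q)) * ‖exp Y - exp Y'‖ := by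
  have hP : 0 ≤ P := (norm_nonneg _).trans hpX
  have hQ : 0 ≤ Q := (norm_nonneg _).trans hqY
  -- both products are in the domain of `log`
  have hdom : ∀ {A B : 𝔸}, ‖exp A - 1‖ ≤ P → ‖exp B - 1‖ ≤ Q → ‖exp A * exp B - 1‖ < 1 := by
    intro A B hA hB
    rw [exp_mul_exp_sub_one]
    have h1 : ‖(exp A - 1) * (exp B - 1)‖ ≤ P * Q := norm_mul_le_of_le hA hB
    have h2 := norm_add₃_le (a := exp A - 1) (b := exp B - 1) (c := (exp A - 1) * (exp B - 1))
    linarith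
  have hs := hasSum_bch_sub hX hY (hdom hpX hqY)
  have hs' := hasSum_bch_sub hX' hY' (hdom hpX' hqY')
  have hd := hs.sub hs'
  -- the termwise majorant
  set a : ℝ := ‖exp X - exp X'‖ with ha
  set b : ℝ := ‖exp Y - exp Y'‖ with hb
  have hpp : ‖(exp X - 1) - (exp X' - 1)‖ = a := by rw [ha]; congr 1; abel
  have hqq : ‖(exp Y - 1) - (exp Y' - 1)‖ = b := by rw [hb]; congr 1; abel
  have hmaj := hasSum_derivMajorant hP hQ hS a b
  -- shift the majorant by one index (`g 0 = 0`)
  let g : ℕ → ℝ := fun n => match n with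
    | 0 => 0
    | m + 1 => ((P + Q + P * Q) ^ m * (1 + Q) - P ^ m) * a + ((P + Q + P * Q) ^ m * (1 + P) - Q ^ m) * b
  have hg : HasSum g ( ((1 + Q) / (1 - (P + Q + P * Q)) - 1 / (1 - P)) * a + ((1 + P) / (1 - (P + Q + P * Q)) - 1 / (1 - Q)) * b ) := by
    refine (hasSum_nat_add_iff' 1).mp ?_
    rw [Finset.sum_range_one]
    change HasSum (fun n : ℕ => ((P + Q + P * Q) ^ n * (1 + Q) - P ^ n) * a + ((P + Q + P * Q) ^ n * (1 + P) - Q ^ n) * b)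
      (( ((1 + Q) / (1 - (P + Q + P * Q)) - 1 / (1 - P)) * a + ((1 + P) / (1 - (P + Q + P * Q)) - 1 / (1 - Q)) * b ) - 0)
    rw [sub_zero]
    exact hmaj
  refine hd.norm_le_of_bounded hg ?_
  intro n
  cases n with
  | zero =>
    simp only [pow_zero, logSeriesCoeff_zero, zero_smul, sub_self, norm_zero]
    exact le_rfl
  | succ m =>
    rw [← smul_sub, norm_smul, norm_logSeriesCoeff_succ]
    have hT := norm_mixedPow_sub_le hpX hpX' hqY hqY' m
    rw [hpp, hqq] at hT
    have hm : (0 : ℝ) < m + 1 := by positivity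
    calc 1 / ((m : ℝ) + 1) * ‖((exp X - 1 + (exp Y - 1) + (exp X - 1) * (exp Y - 1)) ^ (m + 1) - (exp X - 1) ^ (m + 1) - (exp Y - 1) ^ (m + 1))
              - ((exp X' - 1 + (exp Y' - 1) + (exp X' - 1) * (exp Y' - 1)) ^ (m + 1) - (exp X' - 1) ^ (m + 1) - (exp Y' - 1) ^ (m + 1))‖
        ≤ 1 / ((m : ℝ) + 1) * (((m : ℝ) + 1) * ((P + Q + P * Q) ^ m * (1 + Q) - P ^ m) * a + ((m : ℝ) + 1) * ((P + Q + P * Q) ^ m * (1 + P) - Q ^ m) * b) := by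
          gcongr
      _ = ((P + Q + P * Q) ^ m * (1 + Q) - P ^ m) * a + ((P + Q + P * Q) ^ m * (1 + P) - Q ^ m) * b := by
          field_simp
      _ = g (m + 1) := rfl

end Series

/-! ## §3 The letter form for small `X, Y` -/

section Letters

variable {𝔸 : Type*} [NormedRing 𝔸] [NormedAlgebra ℂ 𝔸] [CompleteSpace 𝔸] [NormOneClass 𝔸]

/-- numerics: for `0 ≤ t ≤ 1∕40`, `e^t − 1 ≤ (40∕39)·t` (`e^t ≤ 1∕(1−t)`). [folklore] -/
theorem exp_sub_one_le_of_le_fortieth {t : ℝ} (h0 : 0 ≤ t) (h1 : t ≤ 1 / 40) : Real.exp t - 1 ≤ 40 / 39 * t := by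
  have h := Real.exp_bound_div_one_sub_of_interval h0 (by linarith)
  have h39 : (0 : ℝ) < 1 - t := by linarith
  have e : 1 / (1 - t) - 1 = t / (1 - t) := by field_simp; ring
  have h2 : t / (1 - t) ≤ 40 / 39 * t := by
    rw [div_le_iff₀ h39]; nlinarith
  linarith

/-- The two coefficients for small `P, Q`: `(1+Q)∕(1−S) − 1∕(1−P) = 2Q∕((1−S)(1−P)) ≤ 3Q` when `0 ≤ P, Q ≤ 1∕39`. [folklore] -/
theorem coeff_le {P Q : ℝ} (hP0 : 0 ≤ P) (hQ0 : 0 ≤ Q) (hP1 : P ≤ 1 / 39) (hQ1 : Q ≤ 1 / 39) :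
    (1 + Q) / (1 - (P + Q + P * Q)) - 1 / (1 - P) ≤ 3 * Q := by
  have hS0 : 0 < 1 - (P + Q + P * Q) := by nlinarith
  have h1P : 0 < 1 - P := by linarith
  rw [div_sub_div _ _ hS0.ne' h1P.ne', div_le_iff₀ (mul_pos hS0 h1P)]
  nlinarith [mul_nonneg hP0 hQ0, mul_nonneg (mul_nonneg hP0 hQ0) hQ0, mul_nonneg (mul_nonneg hP0 hQ0) hP0]

/-- ★★ **THE LETTER FORM.**  For `‖X‖, ‖X′‖ ≤ m_X ≤ 1∕40` and `‖Y‖, ‖Y′‖ ≤ m_Y ≤ 1∕40`: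
`‖(log(eˣe^Y) − X − Y) − (log(e^{X′}e^{Y′}) − X′ − Y′)‖ ≤ 4·m_Y·‖X − X′‖ + 4·m_X·‖Y − Y′‖` — the BCH remainder is Lipschitz in each exponent with a constant proportional to the size of the
OTHER exponent. [folklore] [cite: Balaban1985Averaging, (31) p.22] -/
theorem norm_bch_sub_bch_le_of_norm_le {X Y X' Y' : 𝔸} {mX mY : ℝ}
    (hX : ‖X‖ ≤ mX) (hX' : ‖X'‖ ≤ mX) (hY : ‖Y‖ ≤ mY) (hY' : ‖Y'‖ ≤ mY) (hmX : mX ≤ 1 / 40) (hmY : mY ≤ 1 / 40) :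
    ‖(mlog (exp X * exp Y) - X - Y) - (mlog (exp X' * exp Y') - X' - Y')‖
      ≤ 4 * mY * ‖X - X'‖ + 4 * mX * ‖Y - Y'‖ := by
  have hlog2 := Real.log_two_gt_d9
  have hmX0 : 0 ≤ mX := (norm_nonneg _).trans hX
  have hmY0 : 0 ≤ mY := (norm_nonneg _).trans hY
  have hP0 : 0 ≤ 40 / 39 * mX := by positivity
  have hQ0 : 0 ≤ 40 / 39 * mY := by positivity
  have hP1 : 40 / 39 * mX ≤ 1 / 39 := by linarith
  have hQ1 : 40 / 39 * mY ≤ 1 / 39 := by linarith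
  -- `‖e^Z − 1‖ ≤ (40∕39)·m` for each of the four exponents
  have hexp : ∀ {Z : 𝔸} {m : ℝ}, ‖Z‖ ≤ m → m ≤ 1 / 40 → ‖exp Z - 1‖ ≤ 40 / 39 * m := by
    intro Z m hZ hm
    have h := Literature.Analysis.Calculus.norm_exp_sub_one_le Z
    have h2 : Real.exp ‖Z‖ - 1 ≤ Real.exp m - 1 := by linarith [Real.exp_le_exp.mpr hZ]
    exact h.trans (h2.trans (exp_sub_one_le_of_le_fortieth ((norm_nonneg Z).trans hZ) hm))
  have hS : 40 / 39 * mX + 40 / 39 * mY + 40 / 39 * mX * (40 / 39 * mY) < 1 := by nlinarith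
  have hlt : ∀ {Z : 𝔸} {m : ℝ}, ‖Z‖ ≤ m → m ≤ 1 / 40 → ‖Z‖ < Real.log 2 := fun hZ hm => by linarith
  have hmain := norm_bch_sub_bch_le (hlt hX hmX) (hlt hY hmY) (hlt hX' hmX) (hlt hY' hmY)
    (hexp hX hmX) (hexp hX' hmX) (hexp hY hmY) (hexp hY' hmY) hS
  -- Lipschitz of `exp` near `0`
  have hlip : ∀ {Z Z' : 𝔸} {m : ℝ}, ‖Z‖ ≤ m → ‖Z'‖ ≤ m → m ≤ 1 / 40 → ‖exp Z - exp Z'‖ ≤ 40 / 39 * ‖Z - Z'‖ := by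
    intro Z Z' m hZ hZ' hm
    have h := Literature.Analysis.Complex.norm_exp_sub_exp_le Z Z'
    have hm0 : 0 ≤ m := (norm_nonneg Z).trans hZ
    have h2 : Real.exp (max ‖Z‖ ‖Z'‖) ≤ 40 / 39 := by
      have h3 : Real.exp (max ‖Z‖ ‖Z'‖) ≤ Real.exp m := Real.exp_le_exp.mpr (max_le hZ hZ')
      have := exp_sub_one_le_of_le_fortieth hm0 hm
      linarith
    calc ‖exp Z - exp Z'‖ ≤ ‖Z - Z'‖ * Real.exp (max ‖Z‖ ‖Z'‖) := h
      _ ≤ ‖Z - Z'‖ * (40 / 39) := by gcongr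
      _ = 40 / 39 * ‖Z - Z'‖ := by ring
  have heX := hlip hX hX' hmX
  have heY := hlip hY hY' hmY
  have hcP := coeff_le hP0 hQ0 hP1 hQ1
  have hcQ : (1 + 40 / 39 * mX) / (1 - (40 / 39 * mX + 40 / 39 * mY + 40 / 39 * mX * (40 / 39 * mY))) - 1 / (1 - 40 / 39 * mY) ≤ 3 * (40 / 39 * mX) := by
    have h := coeff_le hQ0 hP0 hQ1 hP1
    have e : 40 / 39 * mY + 40 / 39 * mX + 40 / 39 * mY * (40 / 39 * mX) = 40 / 39 * mX + 40 / 39 * mY + 40 / 39 * mX * (40 / 39 * mY) := by ring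
    rw [e] at h
    exact h
  have hcP0 : 0 ≤ (1 + 40 / 39 * mY) / (1 - (40 / 39 * mX + 40 / 39 * mY + 40 / 39 * mX * (40 / 39 * mY))) - 1 / (1 - 40 / 39 * mX) := by
    have hS0 : 0 < 1 - (40 / 39 * mX + 40 / 39 * mY + 40 / 39 * mX * (40 / 39 * mY)) := by linarith
    have h1P : 0 < 1 - 40 / 39 * mX := by linarith
    rw [div_sub_div _ _ hS0.ne' h1P.ne']
    exact div_nonneg (by nlinarith [mul_nonneg hP0 hQ0]) (mul_pos hS0 h1P).le
  have hcQ0 : 0 ≤ (1 + 40 / 39 * mX) / (1 - (40 / 39 * mX + 40 / 39 * mY + 40 / 39 * mX * (40 / 39 * mY))) - 1 / (1 - 40 / 39 * mY) := by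
    have hS0 : 0 < 1 - (40 / 39 * mX + 40 / 39 * mY + 40 / 39 * mX * (40 / 39 * mY)) := by linarith
    have h1Q : 0 < 1 - 40 / 39 * mY := by linarith
    rw [div_sub_div _ _ hS0.ne' h1Q.ne']
    exact div_nonneg (by nlinarith [mul_nonneg hP0 hQ0]) (mul_pos hS0 h1Q).le
  have hdX : 0 ≤ ‖X - X'‖ := norm_nonneg _
  have hdY : 0 ≤ ‖Y - Y'‖ := norm_nonneg _
  refine hmain.trans ?_
  calc _ ≤ (3 * (40 / 39 * mY)) * (40 / 39 * ‖X - X'‖) + (3 * (40 / 39 * mX)) * (40 / 39 * ‖Y - Y'‖) := by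
        gcongr
    _ = (4 * mY * ‖X - X'‖ + 4 * mX * ‖Y - Y'‖) * (3 * 40 * 40 / (39 * 39 * 4)) := by ring
    _ ≤ (4 * mY * ‖X - X'‖ + 4 * mX * ‖Y - Y'‖) * 1 :=
        mul_le_mul_of_nonneg_left (by norm_num)
          (add_nonneg (mul_nonneg (mul_nonneg (by norm_num) hmY0) hdX) (mul_nonneg (mul_nonneg (by norm_num) hmX0) hdY))
    _ = _ := mul_one _

/-- The same with `m_X := max(‖X‖,‖X′‖)`, `m_Y := max(‖Y‖,‖Y′‖)`. [folklore] [cite: Balaban1985Averaging, (31) p.22] -/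
theorem norm_bch_sub_bch_le_max {X Y X' Y' : 𝔸}
    (hX : ‖X‖ ≤ 1 / 40) (hY : ‖Y‖ ≤ 1 / 40) (hX' : ‖X'‖ ≤ 1 / 40) (hY' : ‖Y'‖ ≤ 1 / 40) :
    ‖(mlog (exp X * exp Y) - X - Y) - (mlog (exp X' * exp Y') - X' - Y')‖
      ≤ 4 * max ‖Y‖ ‖Y'‖ * ‖X - X'‖ + 4 * max ‖X‖ ‖X'‖ * ‖Y - Y'‖ :=
  norm_bch_sub_bch_le_of_norm_le (le_max_left _ _) (le_max_right _ _) (le_max_left _ _) (le_max_right _ _) (max_le hX hX') (max_le hY hY')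

end Letters

end Summit.QuantumFields.YangMills.Theorems.Prop7BCHRemainderLipschitz

end
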